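import Summits.CriticalPhenomena.PercolationContinuityZ3.Theorems.PercAnnulusCrossingOneArmQuasiMultDoubling
import Summits.CriticalPhenomena.PercolationContinuityZ3.Theorems.PercAnnulusCrossingOneArmInfluenceBridge
import Summits.CriticalPhenomena.PercolationContinuityZ3.Theorems.PercNearOneGluingNoHeavyRsw3CrossingWindow
import HarnessLib

/-!
# `OneArmQuasiMult ↔ OneArmDoubling` and the influence criterion, in the lane's NAMED statements (lane RSW3, ladder R3.0 / R3.7; seat p1)

builds on p205010 (kernel theorem, internal audit signed; external expert review pending)

Cell `prim-rsw3` (post-continuity programme, LANE 3), seat `prim-rsw3-p1`.  Memo `run/shared/lean/prim/rsw3/P1-QM.md` §2.4–2.5.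
Support file (helper); no definitions, no sorries.  The lead's defs file v2 (p207879) names `Crossing.OneArmDoublingAt d p c`
(`∀ n ≥ 1, c·π_p(n) ≤ π_p(2n)`), `Crossing.OneArmDoubling` (`∃ c > 0, OneArmDoublingAt 3 p_c c`) and `Crossing.OneArmQuasiMultAt d p c` (all scale
pairs); this file states the seat's results against those names:

* `oneArmQuasiMult_iff_oneArmDoubling` — **VERDICTS V6 / ladder R3.0 as a named equivalence**: `OneArmQuasiMult ↔ OneArmDoubling`
  (ratio-4 quasi-multiplicativity ⇔ ratio-2 doubling at `p_c(ℤ³)`; = `oneArmQuasiMult_iff_doubling_two` read through the lead's definitions);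
* `oneArmDoublingAt_of_oneArmQuasiMultAt` — `OneArmQuasiMultAt d p_c c → OneArmDoublingAt d p_c (c·85^{-d})` (`d ≥ 2`; window at ratio 2,
  p2's `Rsw3.le_real_boxCrossing_two_mul_criticalProbI`); the converse fails in general (all scale pairs need unbounded iteration);
* `oneArmDoublingAt_of_influence` — the INFLUENCE CRITERION (`RSW3.oneArmProb_doubling_of_influence`) concluding `OneArmDoublingAt d p (c/(1+c))`
  from the influence hypothesis at every scale `n` (outer scale `2n`, any inner radii `r n`);
* `oneArmDoublingAt_of_normalisedMargin` — the blocking-normalised Harris-margin criterion (`Crossing.cov_arm_boxCrossing_le`) concluding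
  `OneArmDoublingAt d p η`.

References: H. Kesten, *Percolation theory for mathematicians* (1982), Cor. 5.1; H. Duminil-Copin, V. Tassion, Enseign. Math. 62 (2016), §2.1.
-/

noncomputable section

namespace Summit.CriticalPhenomena.PercolationContinuityZ3.Theorems.Crossing

open MeasureTheory Literature.Probability.Percolation Literature.Probability.LatticeModels
open Literature.Probability.Percolation.DCT16
open Summit.CriticalPhenomena.PercolationContinuityZ3.Theorems.SurfaceTension

variable {d : ℕ}

/-- **`OneArmQuasiMult ↔ OneArmDoubling`** (lane VERDICTS V6, ladder R3.0): at `p_c(ℤ³)`, one-arm quasi-multiplicativity at aspect ratio 4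
holds iff the one-arm probability doubles (`∃ c > 0, ∀ n ≥ 1, c·π(n) ≤ π(2n)`). [cite: Kesten1982, Cor. 5.1] -/
theorem oneArmQuasiMult_iff_oneArmDoubling : OneArmQuasiMult ↔ OneArmDoubling := by
  -- (= `oneArmQuasiMult_iff_doubling_two` read through the lead's definitions; written out to stay robust to unfolding)
  rw [oneArmQuasiMult_iff_doubling]
  constructor
  · rintro ⟨c, hc, h⟩
    refine ⟨c, hc, fun n hn => (h n hn).trans ?_⟩
    exact real_siteToBoundary_antitone (criticalProbI 3) (by omega)
  · rintro ⟨c, hc, h⟩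
    refine ⟨c * c, mul_pos hc hc, fun n hn => ?_⟩
    have h1 := h n hn
    have h2 := h (2 * n) (by omega)
    rw [show 2 * (2 * n) = 4 * n by ring] at h2
    calc c * c * oneArmProb 3 (criticalProbI 3) n = c * (c * oneArmProb 3 (criticalProbI 3) n) := by ring
      _ ≤ c * oneArmProb 3 (criticalProbI 3) (2 * n) := mul_le_mul_of_nonneg_left h1 hc.le
      _ ≤ oneArmProb 3 (criticalProbI 3) (4 * n) := h2

/-- **`OneArmQuasiMultAt d p_c c → OneArmDoublingAt d p_c (c·85^{-d})`** (`d ≥ 2`): quasi-multiplicativity over all scale pairs gives doubling,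
through the window `85^{-d} ≤ P_{p_c}(Λ(n) ↔ ∂ⁱⁿΛ(2n))` (p2's `Rsw3.le_real_boxCrossing_two_mul_criticalProbI`). [cite: Kesten1982, Cor. 5.1] -/
theorem oneArmDoublingAt_of_oneArmQuasiMultAt (hd : 2 ≤ d) {c : ℝ} (hc : 0 ≤ c)
    (h : OneArmQuasiMultAt d (criticalProbI d) c) : OneArmDoublingAt d (criticalProbI d) (c * ((85 : ℝ) ^ d)⁻¹) := by
  intro n hn
  have h1 := h n (2 * n) hn (by omega)
  have hwin := Rsw3.le_real_boxCrossing_two_mul_criticalProbI hd hn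
  have hπ : 0 ≤ oneArmProb d (criticalProbI d) n := measureReal_nonneg
  calc c * ((85 : ℝ) ^ d)⁻¹ * oneArmProb d (criticalProbI d) n
      = c * (oneArmProb d (criticalProbI d) n * ((85 : ℝ) ^ d)⁻¹) := by ring
    _ ≤ c * (oneArmProb d (criticalProbI d) n *
          (bondPercolation (zdGraph d) (criticalProbI d)).real (boxCrossing d n (2 * n))) :=
        mul_le_mul_of_nonneg_left (mul_le_mul_of_nonneg_left hwin hπ) hc
    _ ≤ oneArmProb d (criticalProbI d) (2 * n) := h1

/-- In particular `OneArmQuasiMultAt 3 p_c c` (`c > 0`) gives `OneArmDoubling`. [cite: Kesten1982, Cor. 5.1] -/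
theorem oneArmDoubling_of_oneArmQuasiMultAt {c : ℝ} (hc : 0 < c) (h : OneArmQuasiMultAt 3 (criticalProbI 3) c) :
    OneArmDoubling :=
  ⟨c * ((85 : ℝ) ^ 3)⁻¹, by positivity, oneArmDoublingAt_of_oneArmQuasiMultAt (by norm_num) hc.le h⟩

/-- **INFLUENCE CRITERION ⇒ `OneArmDoublingAt`** (every `p`, `d`; inner radii `r n` arbitrary): if at every scale `n ≥ 1` deleting the dying arm
cluster lowers the probability of the crossing `Λ(r n) ↔ ∂ⁱⁿΛ(2n)` by at least `c` on average over `A1(n) ∖ A1(2n)` — the hypothesis of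
`RSW3.oneArmProb_doubling_of_influence` with `N = 2n` — then `OneArmDoublingAt d p (c/(1+c))`. [cite: DuminilCopinTassionEM2016, §2.1] -/
theorem oneArmDoublingAt_of_influence (p : unitInterval) (r : ℕ → ℕ) {c : ℝ} (hc : 0 ≤ c)
    (h : ∀ n : ℕ, 1 ≤ n →
      c * (oneArmProb d p n - oneArmProb d p (2 * n)) ≤
        ∑ K ∈ (box d (2 * n)).powerset.filter (fun K => (∃ z ∈ K, z ∈ innerBoundary (zdGraph d) (box d n)) ∧
            ∀ z ∈ K, z ∉ innerBoundary (zdGraph d) (box d (2 * n))),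
          (bondPercolation (zdGraph d) p).real (clusterEvent (box d (2 * n)) K) *
            ((bondPercolation (zdGraph d) p).real
                {ω | ∃ x ∈ box d (r n), ∃ y ∈ innerBoundary (zdGraph d) (box d (2 * n)),
                  ω ∈ openConnIn (↑(box d (2 * n)) : Set (Site d)) x y} -
              (bondPercolation (zdGraph d) p).real
                {ω | ∃ x ∈ box d (r n), ∃ y ∈ innerBoundary (zdGraph d) (box d (2 * n)),
                  ω ∈ openConnIn ((↑(box d (2 * n)) : Set (Site d)) \ ↑K) x y})) :
    OneArmDoublingAt d p (c / (1 + c)) := fun n hn =>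
  (RSW3.oneArmProb_doubling_of_influence p (by omega : n ≤ 2 * n) (r n) hc (h n hn)).2

/-- **BLOCKING-NORMALISED HARRIS MARGIN ⇒ `OneArmDoublingAt`** (every `p`, `d`; inner radii `r n ≤ 2n`): if at every scale `n ≥ 1` the annulus
`Λ(2n) ∖ Λ(r n)` is not a.s. crossed and `Cov(1_{A1(n)}, 1_{boxCrossing (r n) (2n)}) ≥ η·(1 − α)·π(n)`, then `OneArmDoublingAt d p η`
(`Crossing.doubling_of_normalisedMargin_boxCrossing`). [cite: DuminilCopinTassionEM2016, §2.1] -/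
theorem oneArmDoublingAt_of_normalisedMargin (p : unitInterval) (r : ℕ → ℕ) (hr : ∀ n, r n ≤ 2 * n) {η : ℝ}
    (hα : ∀ n : ℕ, 1 ≤ n → (bondPercolation (zdGraph d) p).real (boxCrossing d (r n) (2 * n)) < 1)
    (h : ∀ n : ℕ, 1 ≤ n →
      η * (1 - (bondPercolation (zdGraph d) p).real (boxCrossing d (r n) (2 * n))) * oneArmProb d p n ≤
        (bondPercolation (zdGraph d) p).real (siteToBoundary d n ∩ boxCrossing d (r n) (2 * n)) -
          oneArmProb d p n * (bondPercolation (zdGraph d) p).real (boxCrossing d (r n) (2 * n))) :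
    OneArmDoublingAt d p η := by
  -- (= `doubling_of_normalisedMargin_boxCrossing` scale by scale; written out from `cov_arm_boxCrossing_le`)
  intro n hn
  have hcov := cov_arm_boxCrossing_le (d := d) p (hr n) (by omega : n ≤ 2 * n)
  have h1 : (1 - (bondPercolation (zdGraph d) p).real (boxCrossing d (r n) (2 * n))) * (η * oneArmProb d p n) ≤
      (1 - (bondPercolation (zdGraph d) p).real (boxCrossing d (r n) (2 * n))) * oneArmProb d p (2 * n) := by
    calc (1 - (bondPercolation (zdGraph d) p).real (boxCrossing d (r n) (2 * n))) * (η * oneArmProb d p n)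
        = η * (1 - (bondPercolation (zdGraph d) p).real (boxCrossing d (r n) (2 * n))) * oneArmProb d p n := by ring
      _ ≤ _ := (h n hn).trans hcov
  exact le_of_mul_le_mul_left h1 (by linarith [hα n hn])

end Summit.CriticalPhenomena.PercolationContinuityZ3.Theorems.Crossing

end
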